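import Literature.MathematicalPhysics.QuantumFieldTheory.Balaban1983to89.B8Ineq192MultiLevelBoxL0
import Literature.MathematicalPhysics.QuantumFieldTheory.Balaban1983to89.B6Geom246MultiLevelBoxL0
import Literature.MathematicalPhysics.QuantumFieldTheory.Balaban1983to89.B6Ineq268MultiLevelBoxL0
import Literature.MathematicalPhysics.QuantumFieldTheory.Balaban1983to89.B6MultiLevelBoxOperatorL0
import Literature.MathematicalPhysics.QuantumFieldTheory.Balaban1983to89.B6Prop22AllMultiLevelBoxL0
/-!
# `Balaban1983to89.B9Ineq349MultiLevelBoxL0` — LEVEL-0 TWIN (programme G-F3′-L0, sub-row G-F3′-L0∕B8 «N05 cone»; director-ym LINE №27 ∕ №35, UV3-NODE §24.5; plan `lit-balaban-r03/G-F3L0-PLAN.md`, row log `lit-balaban-lead/ROW-G-F3p-L0.md` §7) of `B9Ineq349MultiLevelBox`: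
the same declarations, SAME NAMES AND STATEMENTS, for nested families WITH print's region `Λ₀ = T ∖ Ω₁` ADMITTED (structures
`B6MultiLevelBoxOperatorL0.Domains` / `B6MultiLevelTorusOperatorL0.TDomains`: levels `0, …, k`, the level-`0` block a single site, `Q′₀ = id`,
finite weight `a₀` — print p.225 (2.14) «Σ_{j=0}^k … (Q′₀λ)(x) = λ(x), x ∈ Λ₀», p.229 «taking a sequence (2.1) … smallest possible domains B^j(Λ_j),
and considering the operator Δ_a defined by (2.19), (2.20) for this sequence»).  Every `D`-free object is the lineage's, consumed BY NAME; no existing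
module is touched; no fact is minted.  Unit `lit-balaban-p38` (p38 gen 36; second hand of sub-row G-F3′-L0∕B8 «N05 cone» — director-ym №35 2026-08-27T23:07:41Z, OWNER `lit-balaban-r05`, consumer pub-ymgap∕dag-n05-c by endpoint name; port discipline and tooling r03 gen 36∕37, PLAN v1.5); B8 fold owner r05, B9 fold owner r06; referee ref-4.  THE TWIN'S DOCUMENTATION FOLLOWS
VERBATIM (its «levels 1 … k» / «Ω₁ = X» sentences describe the twin; here `j` runs from `0` and `Ω₁` may be a proper subset).

# `Balaban1983to89.B9Ineq349MultiLevelBox` — T. Bałaban, *Propagators for lattice gauge theories in a background field*, Commun.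
# Math. Phys. **99** (1985) 389–434 [Balaban1985BackgroundPropagators], **(3.49)** p. 399 «|P(x,x′)|, |(DP)_μ(x,x′)|, |(PD\*)_ν(x,x′)|,
# |(DPD\*)_{μν}(x,x′)| ≦ O(1)[1, (Lʲη)⁻¹, (Lʲη)⁻¹, (Lʲη)⁻²](L^{j′}η)^{−d}e^{−½δ₀d(y,y′)}» for `P = I − R = G′Q′\*(Q′G′²Q′\*)⁻¹Q′G′` ((3.25))
# **AT U = 1 ON THE GENUINE `k`-LEVEL NEUMANN-BOX FAMILY OF [B6] §2, ALL FOUR ENTRIES, WITH THE GENUINE LEVEL PREFACTORS**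
# (an ARBITRARY nested sequence of block-union domains X = Ω₁ ⊃ … ⊃ Ω_k with (2.1)–(2.2)), the inverse `(Q′G′²Q′\*)⁻¹`
# entering BY ITS PRINTED (2.87)-BOUND — p. 399: «This way the theorems are reduced to the corresponding theorems for
# propagators without external gauge field. They were proved in [4].»

statement-level skeleton of published theorems with citation tags; proofs where landed; nothing here is a claim about the Yang–Mills mass gap

PDF held: `paper:balaban1985-cmp99-background-propagators` (journal page = PDF page + 388); text layer re-read this generation
(`lit read … --pages 11 --grep`): p. 399 [PDF 11] l. 5–9 ((3.49) and «using again Lemma 2.1»), l. 30–32 («reduced to the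
corresponding theorems for propagators without external gauge field. They were proved in [4].»); the display (3.49) itself
(garbled in the text layer) was read as an image by this seat earlier (module `B9Ineq349FlatTorus`, renders
`run/shared/lean/pub/pub-balaban/b2b-balaban-ref1/pages/…background-propagators…-p011.png`), p. 394 [PDF 6] (3.25).

CITATION HEADER (lean-in-tree rule).  Cell `lit-balaban` (HOME `run/shared/lean/pub/lit-balaban/`), unit `lit-balaban-r05` gen 44
(B8 reader/typer; free-target protocol G.5-34(d), TAKING HOME/STATUS 2026-08-22T16:45:15Z; courtesy instance in the B9 block —
owner r06, whose rows B9.Eq3.49 / B9.Eq3.25 keep their heads: the general-background (3.49) is r06's theorem on [4]-shaped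
letters `B9Ineq349Hom.ineq349_hom` / `B9Thm34RFinal` / `B9Thm34PKernelFinal`, with Theorems 3.1/3.2 for the background as
hypotheses of printed shape).  WHAT IS REPRODUCED = the display (3.49) at the flat background U = 1 in the MULTI-LEVEL
geometry of [B6] §2 — after the one-scale torus instance `B9Ineq349FlatTorus` (r05 gen 16: constant domain sequence, every
prefactor `(Lʲη)^{±n} = (L^{j′}η)^{−d}·η^{−d} = 1`) this module proves (3.49) WITH ITS LEVEL PREFACTORS
`[1, (Lʲη)⁻¹, (Lʲη)⁻¹, (Lʲη)⁻²](L^{j′}η)^{−(d+1)}` (spatial dimension `d + 1`, lattice units η = 1) for the GENUINE `k`-level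
operators of seat p21's [B6] §2 programme on a Neumann box: `G′ = Δ′_a⁻¹ = B6MultiLevelBoxOperator.gml` for an arbitrary
nested family `D : Domains d ℓ M_h k P R`, `Q′ = B6Ineq268MultiLevelBoxL0.QB D` / `Q′\* = QsB D` (the normalised block average
and its (2.69)-adjoint), `D_μ = B6Prop22DerivMultiLevelBox.dMat μ` (the forward unit difference = the covariant derivative
(3.3) at U = 1) and `D\*_ν = (dMat ν)ᵀ` (its adjoint for the natural scalar product, p. 391 — the transpose at η = 1), with
the inverse `(Q′G′²Q′\*)⁻¹` of (3.25) entering as an ARGUMENT `G : Module.End ℝ (𝔅 → ℝ)` carrying the kernel bound (2.87)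
`|G(y, y′)| ≦ C₁(Lʲη)⁻⁴(L^{j′}η)^{−(d+1)}e^{−½δ₁d(y,y′)}` (`|mat G y y′ / W D y′| ≤ …`, VERBATIM the shape of conclusion 5 of
p21's `B6Prop23MultiLevelBoxL0.prop23_multiLevelBox`, staged and filing behind P4 at the time of writing) — the device of
`B8Ineq192MultiLevelBox` (p333386), whose engine this file imports.  No `… : Prop` fact is minted (D-0026); when
`prop23_multiLevelBox` is in the tree a three-line corollary discharges the hypothesis (successor note in
HOME/lit-balaban-r05/HANDOFF.md § gen 44).  Kind «kernel-checked proof of a model instance»; one definition with body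
(`pProjML` = the word (3.25) for P on these carriers); every input enters BY NAME; 0 sorry.

WHAT IS PRINTED (verbatim).  p. 399 [PDF 11]: *"These theorems imply all the properties of the operator R, or DRD\*, we will
need in the future. For the operator P = I − R we obtain, using again Lemma 2.1, [|P(x, x′)|, |(DP)_μ(x, x′)|, |(PD\*)_ν(x, x′)|,
|(DPD\*)_{μν}(x, x′)|] ≦ O(1)[1, (Lʲη)⁻¹, (Lʲη)⁻¹, (Lʲη)⁻²](L^{j′}η)^{−d}e^{−½δ₀d(y,y′)} for x ∈ Δ(y), y ∈ Λ_j, x′ ∈ Δ(y′), y′ ∈ Λ_{j′}.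
(3.49) We have also the corresponding bounds for Hölder norms of the kernel (DPD\*)_{μν}(x, x′). Thus the operator Δ_a is well
defined."*; same page: *"This way the theorems are reduced to the corresponding theorems for propagators without external gauge
field. They were proved in [4]."*; p. 394 [PDF 6]: *"Rf = (I − G′Q′\*(Q′G′²Q′\*)⁻¹Q′G′)f, (3.25) where G′ = G′(U) = (Δ′_a)⁻¹"*;
p. 391 [PDF 3]: *"The adjoints are taken with respect to natural L² scalar products"*.  [B6] = [4] of the paper = T. Bałaban,
*Propagators and renormalization transformations for lattice gauge theories. II*, CMP **96** (1984) 223–250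
[Balaban1984PropagatorsII]: Prop. 2.2 (2.67) p. 234 (the `G′`, `∇G′` entries), Prop. 2.3 (2.87) p. 238
«|(Q′G′²Q′\*)⁻¹(y, y′)| ≦ O(1)(Lʲη)⁻⁴(L^{j′}η)^{−d}e^{−½δ₁d(y,y′)}», Lemma 2.1 (2.60)–(2.61) p. 234, the composition rule
(2.52)–(2.55) p. 232 and the scale sum (2.68) p. 235; p. 225 (2.13)–(2.14): `Δ′_a` is a quadratic form (so `G′ᵀ = G′`,
`B6MultiLevelBoxOperator.gml_isSymm`).

WHAT THIS FILE PROVES (kernel; axioms standard).  Setting of `B8Ineq192MultiLevelBox`: fine box `X` in lattice units (η = 1,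
spatial dimension `d + 1`, `L = ℓ + 1`), nested family `D`, blocks `𝔅 = bset D`, block map `y(x) = blkOf D x` (level `j = D.lev x`),
lengths `(geom D).len y = Lʲ`, pairing weights `W D y = (Lʲ)^{d+1}` (= print's `(Lʲη)^{d}` in its `d` dimensions), multiscale
distance `d = (geom D).dist` (2.46), weights `a_j` in a window with `a_{i+1} = aNext ℓ a_i c_i`.
* §1 **`pProjML D a G`** := G′∘(Q′\*∘G∘Q′)∘G′ — the printed word for `P = I − R` with `G` the argument standing for
  `(Q′G′²Q′\*)⁻¹`; `rProjML_eq_one_sub_pProjML` (the `R` of `B8Ineq192MultiLevelBox` §6 IS `1 − pProjML`); `pProjML_idem`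
  (`P² = P`) and `pProjML_rProjML` (`PR = 0`) from the inverse identity `(Q′G′²Q′\*)·G = 1`; the four matrix entries written
  out: `pProjML_single` (`(Pδ_{x′})(x) = (G′Q′\*GQ′(G′δ_{x′}))(x)`), `col_gml_eq_row` / `col_gml_dMat_transpose_eq_row` (THE
  SYMMETRY STEP: the column `x′` of `G′` is its row, the column `x′` of `G′D\*_ν` is the row `x′` of `D_νG′` — `G′ᵀ = G′`).
* §2 `rowBlockSum_le_of_hasMajorant` (a Prop.-2.2 majorant for `T` bounds the absolute row sums of `T` over a block — test
  function = the sign pattern of the row on the block), `abs_QB_row_le` (hence `|(Q′·row)(y′)| ≦ W(y′)⁻¹K(y(x′), y′)`: THE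
  `(L^{j′}η)^{−d}` GAIN of (3.49) is the normalisation of `Q′` acting on a ROW).
* §3 **`pKernel_decay_of_inverse`** — the engine run: for every `C₁, δ₁ > 0` there are `ρ, B, M₀ > 0`, `N₀ ≥ 1` (functions of
  `d, ℓ`, the weight windows, `C₁, δ₁`) such that under the thresholds of the [B6] `k`-level chain (`M_h ≥ 3`, `L·M_h ≥ M₀`,
  `R ≥ 2L`, `R·L·M_h ≥ N₀ + 1`), for every box, family, windowed weights and EVERY `G` with the (2.87)-bound, for every left
  factor `T` with majorant `C·(Lʲ)^{m}e^{−½δ₀d}` (`m ≤ 2`) and every fine matrix `S` with majorant `C·(Lʲ)^{n}e^{−½δ₀d}` (`n ≤ 2`):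
  `|T(Q′\*(G(Q′(row_{x′}S))))(x)| ≦ B·(Lʲ)^{m+n−4}·W(y(x′))⁻¹·e^{−ρd(y(x),y(x′))}` (`j = D.lev x`) — (2.87) on the column, the
  weight `W(y′)⁻¹` moved to `y(x′)` and `(L^{j″})⁻⁴` moved to `y(x)` by (2.60), middle points summed by (2.61), rates by (2.54),
  the right prefactor `(L^{j′})ⁿ` moved to `y(x)` by (2.60) once more.
* §4 **`ineq349_multiLevelBox_of_inverse`** — **(3.49) AT U = 1 ON THE `k`-LEVEL BOX FAMILY, ALL FOUR ENTRIES, GENUINE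
  PREFACTORS**: with `ρ, B, M₀, N₀` as in §3, for all fine points `x, x′` (levels `j = D.lev x`, `j′ = D.lev x′`) and axes `μ, ν`:
  `|P(x,x′)| ≦ B·(L^{j′})^{−(d+1)}e^{−ρd(y(x),y(x′))}`, `|(D_μP)(x,x′)|, |(PD\*_ν)(x,x′)| ≦ B(Lʲ)⁻¹(L^{j′})^{−(d+1)}e^{−ρd}`,
  `|(D_μPD\*_ν)(x,x′)| ≦ B(Lʲ)⁻²(L^{j′})^{−(d+1)}e^{−ρd}` — matrix entries of the genuine finite operators (`P(x,x′) = (Pδ_{x′})(x)`,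
  `(PD\*_ν)(x,x′) = (P(D_νᵀδ_{x′}))(x)`, …; at η = 1 the matrix entry IS the kernel of the pairing Σ_x of p. 391);
  `ineq349_multiLevelBox_R_of_inverse` (the same four bounds for the off-identity part `R − 1 = −P` of (3.25)).

HONEST SCOPE / NOT CLAIMED.  (i) `(Q′G′²Q′\*)⁻¹` is NOT constructed here: it is the argument `G`, constrained by the printed
(2.87)-bound (and, for `P² = P` only, the identity `(Q′G′²Q′\*)G = 1`); the theorems are CONDITIONAL on an inhabitant —
supplied for this very family by p21's `prop23_multiLevelBox` (kernel-checked in p21's folder; P4 `B6Cover236MultiLevelBlocks`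
pending, P5 next at the time of writing).  (ii) U = 1 only (no external gauge field, scalar fibre), Neumann box in place of
`T_η`/`Ω₀`, levels `1 … k` with `Ω₁ = X`, lattice units — exactly the scope of the [B6] `k`-level chain, i.e. the «propagators
without external gauge field» to which p. 399 reduces Theorems 3.1–3.3; the general (3.49) (admissible {Ω_j}, a background
`U` with (3.35)) is r06's theorem on Theorem-3.1/3.2-shaped letters — untouched, heads unchanged.  (iii) The Hölder clause
(«corresponding bounds for Hölder norms of the kernel (DPD\*)_{μν}») is not treated.  (iv) `x ∈ Δ(y), y ∈ Λ_j` is read at the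
point's own block `y(x)` and level `j = D.lev x`; `D\*` = transpose of the forward unit difference of the box (= its adjoint
for the uniform pairing at η = 1); sign conventions play no role in absolute values.  (v) Constants existential and crude
(functions of `d, ℓ`, the windows, `C₁, δ₁`; print: O(1) and ½δ₀ depending on d, L), the rate `ρ = min(δ₀, δ₁)/16` after
three resummations; the (2.61) constant is the `L`-dependent `K261` (`B6Ineq261LevelGap`; the printed `c₁(α)` is refuted as
typed, GAPS G-A11-1); «M, RM sufficiently large» are the explicit thresholds `M₀`, `N₀`.  (vi) Value = the first instance of
(3.49) in the tree whose level prefactors are genuine, complementing r06's letter calculus exactly as `B8Ineq192MultiLevelBox`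
complements `B8Ineq192Op`; NOT summit progress, NOT continuum, NOT Clay.

RELATED IN THE TREE, NOT DUPLICATED (stem check 2026-08-22T16:40Z: `ls Balaban1983to89 | grep -i 349` = `B9Ineq349` (kernel power
counting modulo dictionary, b2b), `B9Ineq349FlatTorus` (r05 g16, one scale, hypothesis-free), `B9Ineq349Hom` /
`B9Ineq349PConcrete` (r06: (3.49) from Thm 3.1/3.2 LETTERS), r06's `B9Thm34RFinal` / `B9Thm34PKernelFinal` ((3.49) for `P(U′U)`);
B12/B14/B1 namesakes of other displays): all cited BY NAME, nothing restated; `B8Ineq192MultiLevelBox` (r05 g43: `rProjML` = (3.25)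
on these carriers with «|Rf| ≦ B′₀|f|», the engine `levelConv_le` / `pow_len_le` / `abs_apply_le_of_levelBound`) is the import.
-/

namespace Literature.MathematicalPhysics.QuantumFieldTheory.Balaban1983to89.B9Ineq349MultiLevelBoxL0

open Finset Matrix
open B4Reflection242 (boxDom)
open B6MultiLevelBoxOperator hiding Domains mlOp_apply
open B6MultiLevelBoxOperatorL0
open B6Geom246MultiLevelBox hiding Touch blkOf blkOf_corner blkOf_eq_iff_blk blkOf_eq_of_blk_i_eq blkOf_val bond bond_adj bset cen connected coord_bounds corner corner_mem csys dist_blkOf_le_box dist_blkOf_le_coord dist_blkOf_le_line dist_cen_le_of_adj dist_cen_le_of_touch dist_le_one_of_near dist_toR_cen_le exists_blkOf_eq geom lemma21_box lev_corner lev_eq_of_blkOf_eq levelGap pack reachable_blkOf reachable_of_near realizes scale_bounds touch_symm triangle_refl_nonneg walk_disp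
open B6Geom246MultiLevelBoxL0
open B6Ineq268MultiLevelBox hiding QB QB_apply QsB QsB_apply W W_eq W_pos Xk abs_qB abs_qB_le card_blkOf_le csysB geomB geomB_L geomB_M geomB_R geomB_RM geomB_RM_nonneg geomB_Site geomB_dist geomB_eta geomB_len geom_len ineq268_multiLevelBox instDecidableEqGeomBSite kerOp_Xk levelSepB qB qB_ne_zero realizesB refl_nonnegB sum_abs_qB_le symmB triangleB
open B6Ineq268MultiLevelBoxL0
open B6Prop22DerivMultiLevelBox (dMat)
open B6Prop22AllMultiLevelBoxL0 (prop22_entries1236_multiLevelBox)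
open B6RandomWalk (HasMajorant BlockSupp hasMajorant_mono)
open B6Ineq261LevelGap (K261 K261_nonneg theta_lt_one_of_log)
open B6Ineq243TwoLevelBox (aNext)
open B6Expansion282 (kerOp)
open B6Prop23Chain (mat apply_eq_sum_mat)
open B8Ineq192MultiLevelBox (abs_apply_le_of_levelBound levelConv_le ineq261With_of_le)
open B8Ineq192MultiLevelBoxL0 (rProjML rProjML_apply QB_gml_gml_QsB len_pos len_eq len_blkOf inv_pow_len_le pow_len_le)

noncomputable section

variable {d : ℕ}

/-! ## §1  `P = I − R = G′Q′*·G·Q′G′` on the `k`-level box family; the matrix entries; the symmetry step `G′ᵀ = G′` -/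

section PProj

variable {ℓ Mh k R : ℕ} {P : Fin (d + 1) → ℕ} (D : Domains d ℓ Mh k P R) (a : ℕ → ℝ)

/-- **`P = I − R = G′Q′*(Q′G′²Q′*)⁻¹Q′G′` at U = 1 on the `k`-level Neumann-box family** — the printed word of (3.25) for
`P`, with the GENUINE multi-level `G′ = Δ′_a⁻¹ = gml`, `Q′ = QB D`, `Q′* = QsB D`, and `G` an operator on `𝔅` standing for
`(Q′G′²Q′*)⁻¹`. [cite: Balaban1985BackgroundPropagators, (3.25) p.394, p.399 («P = I − R»); Balaban1984PropagatorsII, p.235] -/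
def pProjML (G : Module.End ℝ (↥(bset D) → ℝ)) : Module.End ℝ (↥(boxDom (N0 ℓ Mh k P)) → ℝ) :=
  Matrix.toLin' (gml (N0 ℓ Mh k P) ℓ k D.lev a) * (QsB D ∘ₗ G ∘ₗ QB D) * Matrix.toLin' (gml (N0 ℓ Mh k P) ℓ k D.lev a)

variable {D a}

/-- `Pf = G′(Q′*(G(Q′(G′f))))`. [cite: Balaban1985BackgroundPropagators, (3.25) p.394] -/
theorem pProjML_apply (G : Module.End ℝ (↥(bset D) → ℝ)) (f : ↥(boxDom (N0 ℓ Mh k P)) → ℝ) :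
    pProjML D a G f = gml (N0 ℓ Mh k P) ℓ k D.lev a *ᵥ QsB D (G (QB D (gml (N0 ℓ Mh k P) ℓ k D.lev a *ᵥ f))) := by
  simp only [pProjML, Module.End.mul_apply, LinearMap.comp_apply, Matrix.toLin'_apply]

/-- **`R = 1 − P`**: the gauge-fixing projection `rProjML` of `B8Ineq192MultiLevelBox` §6 IS `1 − pProjML` (p. 399 «the
operator P = I − R»). [cite: Balaban1985BackgroundPropagators, (3.25) p.394, p.399] -/
theorem rProjML_eq_one_sub_pProjML (G : Module.End ℝ (↥(bset D) → ℝ)) : rProjML D a G = 1 - pProjML D a G := rfl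

/-- **`P² = P`** (P = I − R is a projection, [4] p. 394 / [B5] p. 25), from the inverse identity `(Q′G′²Q′*)·G = 1`: the middle
letters `Q′G′·G′Q′*` of `P·P` ARE `Q′G′²Q′*` (`QB_gml_gml_QsB`). [cite: Balaban1985BackgroundPropagators, (3.25) p.394; Balaban1984PropagatorsI, p.25] -/
theorem pProjML_idem {G : Module.End ℝ (↥(bset D) → ℝ)} (hG : kerOp (W D) (Xk D a) * G = 1)
    (f : ↥(boxDom (N0 ℓ Mh k P)) → ℝ) : pProjML D a G (pProjML D a G f) = pProjML D a G f := by
  have h2 : ∀ v, kerOp (W D) (Xk D a) (G v) = v := fun v => by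
    have h := congrArg (fun T : Module.End ℝ (↥(bset D) → ℝ) => T v) hG
    simpa only [Module.End.mul_apply, Module.End.one_apply] using h
  conv_lhs => rw [pProjML_apply]
  rw [pProjML_apply, QB_gml_gml_QsB, h2]

/-- **`P·R = 0`** (complementary projections), from the same identity. [cite: Balaban1985BackgroundPropagators, (3.25) p.394] -/
theorem pProjML_rProjML {G : Module.End ℝ (↥(bset D) → ℝ)} (hG : kerOp (W D) (Xk D a) * G = 1)
    (f : ↥(boxDom (N0 ℓ Mh k P)) → ℝ) : pProjML D a G (rProjML D a G f) = 0 := by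
  rw [rProjML_eq_one_sub_pProjML, LinearMap.sub_apply, Module.End.one_apply, map_sub, pProjML_idem hG, sub_self]

/-- a column of a matrix: `(Mδ_{x′})(w) = M(w, x′)`. [folklore] -/
private theorem mulVec_single_one_apply (M : Matrix ↥(boxDom (N0 ℓ Mh k P)) ↥(boxDom (N0 ℓ Mh k P)) ℝ)
    (w x' : ↥(boxDom (N0 ℓ Mh k P))) : (M *ᵥ Pi.single x' 1) w = M w x' := by
  simp [Matrix.mulVec, dotProduct, Pi.single_apply]

/-- **THE SYMMETRY STEP, entry `G′`**: the column `x′` of `G′` is its row `x′` — `Δ′_a` is a quadratic form ((2.13)–(2.14)), so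
`G′ᵀ = G′` (`gml_isSymm`). [cite: Balaban1984PropagatorsII, (2.13)–(2.14) p.225; Balaban1985BackgroundPropagators, p.391 («natural L² scalar products»)] -/
theorem col_gml_eq_row (x' : ↥(boxDom (N0 ℓ Mh k P))) :
    gml (N0 ℓ Mh k P) ℓ k (B6MultiLevelBoxOperatorL0.Domains.lev D) a *ᵥ Pi.single x' 1 = fun w => gml (N0 ℓ Mh k P) ℓ k D.lev a x' w := by
  funext w
  rw [mulVec_single_one_apply]
  exact (gml_isSymm (N := N0 ℓ Mh k P) (ℓ := ℓ) (k := k) (lev := D.lev) (a := a)).apply x' w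

/-- **THE SYMMETRY STEP, entry `G′D*_ν`**: the column `x′` of `G′·D_νᵀ` is the row `x′` of `D_ν·G′` — `(G′D_νᵀ)ᵀ = D_νG′ᵀ = D_νG′`.
[cite: Balaban1984PropagatorsII, (2.13)–(2.14) p.225; Balaban1985BackgroundPropagators, p.391, (3.49) p.399 (entry (PD\*)_ν)] -/
theorem col_gml_dMat_transpose_eq_row (ν : Fin (d + 1)) (x' : ↥(boxDom (N0 ℓ Mh k P))) :
    (gml (N0 ℓ Mh k P) ℓ k (B6MultiLevelBoxOperatorL0.Domains.lev D) a * (dMat (N0 ℓ Mh k P) ν)ᵀ) *ᵥ Pi.single x' 1 =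
      fun w => (dMat (N0 ℓ Mh k P) ν * gml (N0 ℓ Mh k P) ℓ k D.lev a) x' w := by
  funext w
  rw [mulVec_single_one_apply]
  have h : (dMat (N0 ℓ Mh k P) ν * gml (N0 ℓ Mh k P) ℓ k D.lev a)ᵀ =
      gml (N0 ℓ Mh k P) ℓ k D.lev a * (dMat (N0 ℓ Mh k P) ν)ᵀ := by
    rw [Matrix.transpose_mul, (gml_isSymm (N := N0 ℓ Mh k P) (ℓ := ℓ) (k := k) (lev := D.lev) (a := a)).eq]
  rw [← h, Matrix.transpose_apply]

/-- `D_νᵀδ_{x′}` fed to `G′`: `G′(D_νᵀδ_{x′}) = (G′D_νᵀ)δ_{x′}` = the row `x′` of `D_νG′`. [folklore] -/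
private theorem gml_mulVec_dMat_transpose_single (ν : Fin (d + 1)) (x' : ↥(boxDom (N0 ℓ Mh k P))) :
    gml (N0 ℓ Mh k P) ℓ k D.lev a *ᵥ ((dMat (N0 ℓ Mh k P) ν)ᵀ *ᵥ Pi.single x' 1) =
      fun w => (dMat (N0 ℓ Mh k P) ν * gml (N0 ℓ Mh k P) ℓ k D.lev a) x' w := by
  rw [Matrix.mulVec_mulVec, col_gml_dMat_transpose_eq_row]

/-- **the matrix entry `P(x, x′) = (Pδ_{x′})(x)` written out**: `(Pδ_{x′})(x) = (G′·Q′*G Q′(row_{x′}G′))(x)`.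
[cite: Balaban1985BackgroundPropagators, (3.25) p.394, (3.49) p.399] -/
theorem pProjML_single (G : Module.End ℝ (↥(bset D) → ℝ)) (x' : ↥(boxDom (N0 ℓ Mh k P))) :
    pProjML D a G (Pi.single x' 1) =
      gml (N0 ℓ Mh k P) ℓ k D.lev a *ᵥ QsB D (G (QB D fun w => gml (N0 ℓ Mh k P) ℓ k D.lev a x' w)) := by
  rw [pProjML_apply, col_gml_eq_row]

/-- **the matrix entry `(PD*_ν)(x, x′) = (P(D_νᵀδ_{x′}))(x)` written out**: `= (G′·Q′*G Q′(row_{x′}(D_νG′)))(x)`.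
[cite: Balaban1985BackgroundPropagators, (3.25) p.394, (3.49) p.399] -/
theorem pProjML_dMat_transpose_single (G : Module.End ℝ (↥(bset D) → ℝ)) (ν : Fin (d + 1))
    (x' : ↥(boxDom (N0 ℓ Mh k P))) :
    pProjML D a G ((dMat (N0 ℓ Mh k P) ν)ᵀ *ᵥ Pi.single x' 1) =
      gml (N0 ℓ Mh k P) ℓ k D.lev a *ᵥ
        QsB D (G (QB D fun w => (dMat (N0 ℓ Mh k P) ν * gml (N0 ℓ Mh k P) ℓ k D.lev a) x' w)) := by
  rw [pProjML_apply, gml_mulVec_dMat_transpose_single]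

end PProj

/-! ## §2  Row block sums under a Prop.-2.2 majorant; the `(L^{j′}η)^{−d}` gain of `Q′` on a row -/

section RowSums

variable {ℓ Mh k R : ℕ} {P : Fin (d + 1) → ℕ} {D : Domains d ℓ Mh k P R}

/-- **a block majorant bounds the absolute row sums over the block** ((2.51)/(2.66) tested on the sign pattern of the row):
if `T` has majorant `K` for the block map `y(·)`, then `Σ_{w∈B(y′)}|T(x, w)| ≦ K(y(x), y′)`. [cite: Balaban1984PropagatorsII, (2.51) p.232, (2.64)–(2.66) p.234] -/
theorem rowBlockSum_le_of_hasMajorant {T : Matrix ↥(boxDom (N0 ℓ Mh k P)) ↥(boxDom (N0 ℓ Mh k P)) ℝ}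
    {K : ↥(B6Geom246MultiLevelBoxL0.bset D) → ↥(bset D) → ℝ} (hT : HasMajorant (g := geom D) (blkOf D) (Matrix.toLin' T) K)
    (x : ↥(boxDom (N0 ℓ Mh k P))) (y' : ↥(bset D)) :
    ∑ w ∈ Finset.univ.filter (fun w => blkOf D w = y'), |T x w| ≤ K (blkOf D x) y' := by
  classical
  -- the test function: the sign pattern of the row `x` on the block `B(y′)`
  set μ : ↥(boxDom (N0 ℓ Mh k P)) → ℝ :=
    fun w => if blkOf D w = y' then (if 0 ≤ T x w then 1 else -1) else 0 with hμ
  have hsupp : BlockSupp (g := geom D) (blkOf D) μ y' 1 := by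
    refine ⟨zero_le_one, fun w hw => ?_, fun w hw => ?_⟩
    · have hw' : blkOf D w = y' := hw
      simp only [hμ, hw', if_true]
      split_ifs <;> simp
    · have hw' : ¬ blkOf D w = y' := hw
      simp only [hμ]
      exact if_neg hw'
  have h := hT y' μ 1 hsupp x
  rw [mul_one, Matrix.toLin'_apply] at h
  have hsum : (T *ᵥ μ) x = ∑ w ∈ Finset.univ.filter (fun w => blkOf D w = y'), |T x w| := by
    rw [Matrix.mulVec, dotProduct, Finset.sum_filter]
    refine Finset.sum_congr rfl fun w _ => ?_
    simp only [hμ]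
    split_ifs with h1 h2
    · rw [mul_one, abs_of_nonneg h2]
    · rw [mul_neg, mul_one, abs_of_neg (lt_of_not_ge h2)]
    · rw [mul_zero]
  rw [hsum] at h
  exact le_trans (le_abs_self _) h

/-- **THE `(L^{j′}η)^{−d}` GAIN: `Q′` applied to a ROW** — `|(Q′·row_{x′}T)(y′)| = W(y′)⁻¹|Σ_{w∈B(y′)}T(x′, w)| ≦ W(y′)⁻¹K(y(x′), y′)`
(the normalisation `(L^{j′}η)^{−(d+1)}` of the block mean survives, the block sum is paid by the majorant).
[cite: Balaban1984PropagatorsII, (2.14)–(2.15) p.225, (2.66) p.234; Balaban1985BackgroundPropagators, (3.49) p.399 (the factor (L^{j′}η)^{−d})] -/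
theorem abs_QB_row_le {T : Matrix ↥(boxDom (N0 ℓ Mh k P)) ↥(boxDom (N0 ℓ Mh k P)) ℝ}
    {K : ↥(B6Geom246MultiLevelBoxL0.bset D) → ↥(bset D) → ℝ} (hT : HasMajorant (g := geom D) (blkOf D) (Matrix.toLin' T) K)
    (x' : ↥(boxDom (N0 ℓ Mh k P))) (y' : ↥(bset D)) :
    |QB D (fun w => T x' w) y'| ≤ (W D y')⁻¹ * K (blkOf D x') y' := by
  have hW := W_pos D y'
  rw [QB_apply, abs_mul, abs_of_pos (inv_pos.2 hW)]
  refine mul_le_mul_of_nonneg_left ?_ (inv_nonneg.2 hW.le)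
  exact (Finset.abs_sum_le_sum_abs _ _).trans (rowBlockSum_le_of_hasMajorant hT x' y')

end RowSums

/-! ## §3  The engine run: `T·Q′*·G·Q′·row_{x′}S` for a left factor `T` and a right row `S` with Prop.-2.2 majorants -/

section Kernel

/-- a negative real power of a positive length is the inverse of the natural power. [folklore] -/
private theorem rpow_neg_natCast_eq {x : ℝ} (hx : 0 < x) (n : ℕ) : x ^ (-(n : ℝ)) = (x ^ n)⁻¹ := by
  rw [Real.rpow_neg hx.le, Real.rpow_natCast]

/-- the same for the printed exponent `−4`. [folklore] -/
private theorem rpow_neg_four_eq {x : ℝ} (hx : 0 < x) : x ^ (-(4 : ℝ)) = (x ^ 4)⁻¹ := by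
  rw [show (-(4 : ℝ)) = -((4 : ℕ) : ℝ) by norm_num]
  exact rpow_neg_natCast_eq hx 4

/-- **THE ENGINE RUN FOR ONE WORD `T·Q′*G Q′·row_{x′}S`** (p. 399 «using again Lemma 2.1», realised with the flat predecessors
[B6] Prop. 2.2/2.3/Lemma 2.1): for every `C₁, δ₁ > 0` there are `ρ, B, M₀ > 0`, `N₀ ≥ 1` such that for every `k`, `M_h ≥ 3` with
`L·M_h ≥ M₀`, `R ≥ 2L` with `R·L·M_h ≥ N₀ + 1`, every box `P`, every nested family `D` with (2.1)–(2.2), every windowed weight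
sequence, EVERY `G` on `𝔅` with the (2.87)-bound (constants `C₁, δ₁`), every left factor `T` with the Prop.-2.2 majorant
`C(Lʲ)^{m}e^{−½δ₀d}` and every fine matrix `S` with majorant `C(Lʲ)^{n}e^{−½δ₀d}` (`m, n ≤ 2`; `C, δ₀` the constants of
`prop22_entries1236_multiLevelBox`), and all fine points `x, x′`:
`|T(Q′*(G(Q′(row_{x′}S))))(x)| ≦ B·(Lʲ)^{m}(Lʲ)^{n}((Lʲ)⁴)⁻¹·W(y(x′))⁻¹·e^{−ρd(y(x),y(x′))}`, `j = D.lev x`.  Chain: `|Q′(row_{x′}S)(y′)| ≦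
W(y′)⁻¹C(L^{j′})ⁿe^{−½δ₀d(y(x′),y′)}` (§2); `|G(…)(y″)| ≦ C₁CL^{d+1}c·(L^{j′})ⁿ(L^{j″})⁻⁴W(y(x′))⁻¹e^{−ρ₁d}` ((2.87), the weight
`W(y′)⁻¹` moved to `y(x′)` by (2.60), summed by (2.61), (2.54)); `|T(Q′*…)(x)| ≦ …·CL⁴c·(Lʲ)^{m}(Lʲ)⁻⁴e^{−ρ₂d}` (Prop. 2.2, the
weight `(L^{j″})⁻⁴` moved to `y(x)`); finally `(L^{j′})ⁿ ≦ L²e^{σd}(Lʲ)ⁿ` ((2.60)). [cite: Balaban1985BackgroundPropagators, (3.49) p.399, (3.25) p.394; Balaban1984PropagatorsII, Prop. 2.2 (2.67) p.234, Prop. 2.3 (2.87) p.238, Lemma 2.1 (2.60)–(2.61) p.234, (2.52)–(2.55) p.232, (2.68) p.235] -/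
theorem pKernel_decay_of_inverse (d ℓ : ℕ) (hℓ : 1 ≤ ℓ) (aminus aplus a2minus a2plus : ℝ) (ha : 0 < aminus)
    (ha2 : 0 < a2minus) {C₁ δ₁ : ℝ} (hC₁ : 0 < C₁) (hδ₁ : 0 < δ₁) :
    ∃ δ₀ C ρ B M₀ : ℝ, ∃ N₀ : ℕ, 0 < δ₀ ∧ 0 < C ∧ 0 < ρ ∧ 0 < B ∧ 0 < M₀ ∧ 0 < N₀ ∧
      ∀ (k Mh R : ℕ), 3 ≤ Mh → M₀ ≤ ((ℓ : ℝ) + 1) * Mh → 2 * (ℓ + 1) ≤ R → N₀ + 1 ≤ R * ((ℓ + 1) * Mh) →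
      ∀ (P : Fin (d + 1) → ℕ) (_hP : ∀ μ, 1 ≤ P μ) (D : Domains d ℓ Mh k P R) (a c : ℕ → ℝ),
        (∀ i, aminus ≤ a i ∧ a i ≤ aplus) → (∀ i, a2minus ≤ c i ∧ c i ≤ a2plus) →
        (∀ i, a (i + 1) = aNext ℓ (a i) (c i)) →
        -- the Prop.-2.2 majorants of this family, with these very constants `δ₀, C`
        HasMajorant (g := geom D) (blkOf D) (Matrix.toLin' (gml (N0 ℓ Mh k P) ℓ k D.lev a))
            (fun y y' => C * (geom D).len y ^ 2 * Real.exp (-(δ₀ / 2 * (geom D).dist y y'))) ∧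
        (∀ μ : Fin (d + 1), HasMajorant (g := geom D) (blkOf D)
            (Matrix.toLin' (dMat (N0 ℓ Mh k P) μ * gml (N0 ℓ Mh k P) ℓ k D.lev a))
            (fun y y' => C * (geom D).len y ^ 1 * Real.exp (-(δ₀ / 2 * (geom D).dist y y')))) ∧
        ∀ G : Module.End ℝ (↥(bset D) → ℝ),
          (∀ y y' : ↥(bset D), |mat G y y' / W D y'| ≤
            C₁ * (geom D).len y ^ (-(4 : ℝ)) * (geom D).len y' ^ (-((d + 1 : ℕ) : ℝ)) *
              Real.exp (-(δ₁ / 2 * (geom D).dist y y'))) →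
          ∀ (T : Module.End ℝ (↥(boxDom (N0 ℓ Mh k P)) → ℝ))
            (S : Matrix ↥(boxDom (N0 ℓ Mh k P)) ↥(boxDom (N0 ℓ Mh k P)) ℝ) (m n : ℕ), m ≤ 2 → n ≤ 2 →
            HasMajorant (g := geom D) (blkOf D) T
              (fun y y' => C * (geom D).len y ^ m * Real.exp (-(δ₀ / 2 * (geom D).dist y y'))) →
            HasMajorant (g := geom D) (blkOf D) (Matrix.toLin' S)
              (fun y y' => C * (geom D).len y ^ n * Real.exp (-(δ₀ / 2 * (geom D).dist y y'))) →
            ∀ x x' : ↥(boxDom (N0 ℓ Mh k P)),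
              |T (QsB D (G (QB D fun w => S x' w))) x| ≤
                B * ((((ℓ : ℝ) + 1) ^ D.lev x.1) ^ m * (((ℓ : ℝ) + 1) ^ D.lev x.1) ^ n *
                  ((((ℓ : ℝ) + 1) ^ D.lev x.1) ^ 4)⁻¹) * (W D (blkOf D x'))⁻¹ *
                  Real.exp (-(ρ * (geom D).dist (blkOf D x) (blkOf D x'))) := by
  obtain ⟨δ₀, C, M₀, N₀, hδ₀, hC, hM₀, hN₀, h22⟩ :=
    prop22_entries1236_multiLevelBox d ℓ hℓ aminus aplus a2minus a2plus ha ha2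
  have hL0 : (0 : ℝ) < (ℓ : ℝ) + 1 := by positivity
  have hL1 : (1 : ℝ) ≤ (ℓ : ℝ) + 1 := by linarith [(Nat.cast_nonneg ℓ : (0 : ℝ) ≤ ℓ)]
  have hlog : Real.log ((ℓ : ℝ) + 1) ≤ (ℓ : ℝ) + 1 := (Real.log_le_sub_one_of_pos hL0).trans (by linarith)
  have hlog0 : 0 ≤ Real.log ((ℓ : ℝ) + 1) := Real.log_nonneg hL1
  -- the rate unit `σ = min(δ₀, δ₁)/16` and the (2.59)-type threshold `N₁`
  obtain ⟨σ, hσ⟩ : ∃ σ : ℝ, σ = min (δ₀ / 16) (δ₁ / 16) := ⟨_, rfl⟩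
  have hσ0 : 0 < σ := by rw [hσ]; exact lt_min (by positivity) (by positivity)
  have hσδ₀ : σ ≤ δ₀ / 16 := by rw [hσ]; exact min_le_left _ _
  have hσδ₁ : σ ≤ δ₁ / 16 := by rw [hσ]; exact min_le_right _ _
  obtain ⟨N₁, hN₁⟩ : ∃ N₁ : ℕ, N₁ = ⌈128 * ((d : ℝ) + 1) * ((ℓ : ℝ) + 1) / σ⌉₊ + 1 := ⟨_, rfl⟩
  have hN₁pos : 0 < N₁ := by rw [hN₁]; omega
  have hN₁gt : 128 * ((d : ℝ) + 1) * ((ℓ : ℝ) + 1) < σ * (N₁ : ℝ) := by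
    have h : 128 * ((d : ℝ) + 1) * ((ℓ : ℝ) + 1) / σ < (N₁ : ℝ) := by
      rw [hN₁]; push_cast
      exact lt_of_le_of_lt (Nat.le_ceil _) (by linarith)
    rw [div_lt_iff₀ hσ0] at h
    linarith
  -- the (2.61)-constant and the constant `B`
  obtain ⟨cK, hcK⟩ : ∃ cK : ℝ, cK = K261 N₁ (d + 1) ((ℓ : ℝ) + 1) 1 (1 * σ) := ⟨_, rfl⟩
  have hcK0 : 0 ≤ cK := by rw [hcK]; exact K261_nonneg hL0.le zero_le_one
  obtain ⟨B, hB⟩ : ∃ B : ℝ, B = C₁ * C ^ 2 * ((ℓ : ℝ) + 1) ^ (d + 7) * cK ^ 2 := ⟨_, rfl⟩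
  have hB0 : 0 ≤ B := by rw [hB]; positivity
  refine ⟨δ₀, C, σ, B + 1, M₀, max N₀ N₁, hδ₀, hC, hσ0, by linarith, hM₀, lt_of_lt_of_le hN₀ (le_max_left _ _), ?_⟩
  intro k Mh R hMh hM hR hRM P hP D a c haw hcw hac
  have hMh1 : 1 ≤ Mh := le_trans (by norm_num) hMh
  have hRM0 : N₀ + 1 ≤ R * ((ℓ + 1) * Mh) := le_trans (Nat.succ_le_succ (le_max_left _ _)) hRM
  have hRM1 : N₁ + 1 ≤ R * ((ℓ + 1) * Mh) := le_trans (Nat.succ_le_succ (le_max_right _ _)) hRM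
  have hRMone : 1 ≤ R * ((ℓ + 1) * Mh) := le_trans (by omega) hRM1
  obtain ⟨hTG, hTD, -, -⟩ := h22 k Mh R hMh hM hR hRM0 P hP D a c haw hcw hac
  have htri := (triangle_refl_nonneg D hMh1 hP).1
  have hdnn := (triangle_refl_nonneg D hMh1 hP).2.2
  have hlen0 : ∀ y : ↥(bset D), 0 ≤ (geom D).len y := fun y => (len_pos D y).le
  -- the Prop.-2.2 majorants with the lengths `(geom D).len`
  have hTG' : HasMajorant (g := geom D) (blkOf D) (Matrix.toLin' (gml (N0 ℓ Mh k P) ℓ k D.lev a))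
      (fun y y' => C * (geom D).len y ^ 2 * Real.exp (-(δ₀ / 2 * (geom D).dist y y'))) := by
    refine hasMajorant_mono (g := geom D) (blkOf D) hTG fun y y' => le_of_eq ?_
    rw [len_eq, ← pow_mul, Nat.mul_comm]
  have hTD' : ∀ μ : Fin (d + 1), HasMajorant (g := geom D) (blkOf D)
      (Matrix.toLin' (dMat (N0 ℓ Mh k P) μ * gml (N0 ℓ Mh k P) ℓ k D.lev a))
      (fun y y' => C * (geom D).len y ^ 1 * Real.exp (-(δ₀ / 2 * (geom D).dist y y'))) := by
    intro μ
    refine hasMajorant_mono (g := geom D) (blkOf D) (hTD μ) fun y y' => le_of_eq ?_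
    rw [len_eq, pow_one]
  refine ⟨hTG', hTD', ?_⟩
  intro G hG T S m n hm hn hT hS x x'
  -- Lemma 2.1 on the box at the rate `σ`, and every larger rate
  have hθ : Real.exp (-(1 * σ)) * ((ℓ : ℝ) + 1) ^ ((2 * (d + 1 : ℕ) : ℝ) / N₁) < 1 := by
    refine theta_lt_one_of_log hL0 hN₁pos ?_
    push_cast
    nlinarith [mul_le_mul_of_nonneg_left hlog (by positivity : (0 : ℝ) ≤ 2 * ((d : ℝ) + 1))]
  obtain ⟨-, h261, -, -⟩ := lemma21_box D hMh1 hP hN₁pos hRM1 hσ0.le (α := 1) zero_le_one le_rfl hθ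
  rw [← hcK] at h261
  have hrow : ∀ τ : ℝ, σ ≤ τ → ∀ y : (geom D).Site,
      ∑ y'' : (geom D).Site, Real.exp (-(τ * (geom D).dist y y'')) ≤ cK := by
    intro τ hτ y
    have h := ineq261With_of_le (g := geom D) h261 (δ' := τ) (α' := 1) (by linarith) hdnn y
    simpa only [one_mul] using h
  -- the thresholds `Lⁿ ≤ e^{β(RM−1)}` for `n ≤ d + 5` at every absorption rate `β ≥ σ`
  have hthr : ∀ (q : ℕ) (β : ℝ), q ≤ d + 5 → σ ≤ β →
      ((ℓ : ℝ) + 1) ^ q ≤ Real.exp (β * ((geomB D).R * (geomB D).M)) := by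
    intro q β hq hβ
    rw [geomB_RM D hMh1]
    have hge : (N₁ : ℝ) ≤ (R : ℝ) * (((ℓ : ℝ) + 1) * Mh) - 1 := by
      have : ((N₁ + 1 : ℕ) : ℝ) ≤ ((R * ((ℓ + 1) * Mh) : ℕ) : ℝ) := by exact_mod_cast hRM1
      push_cast at this; linarith
    have hq' : (q : ℝ) ≤ (d : ℝ) + 5 := by exact_mod_cast hq
    have h4 : (q : ℝ) * Real.log ((ℓ : ℝ) + 1) ≤ β * ((R : ℝ) * (((ℓ : ℝ) + 1) * Mh) - 1) := by
      have h1 : σ * (N₁ : ℝ) ≤ β * ((R : ℝ) * (((ℓ : ℝ) + 1) * Mh) - 1) :=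
        calc σ * (N₁ : ℝ) ≤ β * (N₁ : ℝ) := mul_le_mul_of_nonneg_right hβ (Nat.cast_nonneg _)
          _ ≤ β * ((R : ℝ) * (((ℓ : ℝ) + 1) * Mh) - 1) := mul_le_mul_of_nonneg_left hge (by linarith)
      have hd0 : (0 : ℝ) ≤ (d : ℝ) := Nat.cast_nonneg d
      have hq0 : (0 : ℝ) ≤ (q : ℝ) := Nat.cast_nonneg q
      nlinarith [mul_le_mul_of_nonneg_left hlog hq0, mul_nonneg hd0 hlog0]
    calc ((ℓ : ℝ) + 1) ^ q = Real.exp ((q : ℝ) * Real.log ((ℓ : ℝ) + 1)) := by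
          rw [← Real.exp_log (pow_pos hL0 q), Real.log_pow]
      _ ≤ _ := Real.exp_le_exp.2 h4
  -- STEP R (§2): `|Q′(row_{x′}S)(y′)| ≤ W(y′)⁻¹·C(L^{j(x′)})ⁿ·e^{−½δ₀d(y(x′),y′)}`
  have hv : ∀ y' : ↥(bset D), |QB D (fun w => S x' w) y'| ≤
      (W D y')⁻¹ * (C * (geom D).len (blkOf D x') ^ n * Real.exp (-(δ₀ / 2 * (geom D).dist (blkOf D x') y'))) :=
    fun y' => abs_QB_row_le hS x' y'
  -- STEP G ((2.87) on the column; the weight `W(y′)⁻¹ = (L^{j′})^{−(d+1)}` moved to `y(x′)` by (2.60), summed by (2.61))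
  have hmat : ∀ y y' : ↥(bset D), |mat G y y'| ≤
      C₁ * ((geom D).len y ^ 4)⁻¹ * Real.exp (-(δ₁ / 2 * (geom D).dist y y')) := by
    intro y y'
    have h := hG y y'
    have hWpos := W_pos D y'
    have hW : W D y' = (geom D).len y' ^ (d + 1) := rfl
    rw [abs_div, abs_of_pos hWpos, div_le_iff₀ hWpos, rpow_neg_four_eq (len_pos D y),
      rpow_neg_natCast_eq (len_pos D y'), hW] at h
    calc |mat G y y'| ≤ _ := h
      _ = C₁ * ((geom D).len y ^ 4)⁻¹ * Real.exp (-(δ₁ / 2 * (geom D).dist y y')) *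
            (((geom D).len y' ^ (d + 1))⁻¹ * (geom D).len y' ^ (d + 1)) := by ring
      _ = C₁ * ((geom D).len y ^ 4)⁻¹ * Real.exp (-(δ₁ / 2 * (geom D).dist y y')) := by
            rw [inv_mul_cancel₀ (pow_pos (len_pos D y') _).ne', mul_one]
  have hWinv : ∀ y y'' : (geom D).Site, (W D y'')⁻¹ ≤
      ((ℓ : ℝ) + 1) ^ (d + 1) * Real.exp (2 * σ * (geom D).dist y y'') * (W D y)⁻¹ :=
    fun y y'' => inv_pow_len_le hMh1 hP hRMone (d + 1) (by positivity) (hthr (d + 1) (2 * σ) (by omega) (by linarith)) y y''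
  have hGv : ∀ y'' : ↥(bset D), |G (QB D fun w => S x' w) y''| ≤
      C₁ * C * ((ℓ : ℝ) + 1) ^ (d + 1) * cK * (geom D).len (blkOf D x') ^ n * (W D (blkOf D x'))⁻¹ *
        ((geom D).len y'' ^ 4)⁻¹ * Real.exp (-(4 * σ * (geom D).dist (blkOf D x') y'')) := by
    intro y''
    have hn4 : 0 ≤ C₁ * ((geom D).len y'' ^ 4)⁻¹ := mul_nonneg hC₁.le (inv_nonneg.2 (pow_nonneg (hlen0 y'') 4))
    have hpn : 0 ≤ C * (geom D).len (blkOf D x') ^ n := mul_nonneg hC.le (pow_nonneg (hlen0 _) n)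
    -- the mirrored 𝔅-convolution: `Σ_{y′}e^{−½δ₀d(y(x′),y′)}W(y′)⁻¹e^{−½δ₁d(y′,y″)} ≤ L^{d+1}c·W(y(x′))⁻¹e^{−4σd(y(x′),y″)}`
    have h2 := levelConv_le (g := geom D) htri hdnn (σ₁ := δ₀ / 2) (σ₂ := δ₁ / 2) (β := 2 * σ) (ρ := 4 * σ)
      (τ := 2 * σ) (A := ((ℓ : ℝ) + 1) ^ (d + 1)) (c := cK) (by positivity) (by linarith) (by linarith) (by positivity)
      (f := fun b => (W D b)⁻¹) (fun b => inv_nonneg.2 (W_pos D b).le) hWinv (hrow (2 * σ) (by linarith)) (blkOf D x') y''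
    have h2' : ∑ y' : ↥(bset D), Real.exp (-(δ₀ / 2 * (geom D).dist (blkOf D x') y')) * (W D y')⁻¹ *
        Real.exp (-(δ₁ / 2 * (geom D).dist y' y'')) ≤
        ((ℓ : ℝ) + 1) ^ (d + 1) * cK * (W D (blkOf D x'))⁻¹ * Real.exp (-(4 * σ * (geom D).dist (blkOf D x') y'')) := h2
    rw [apply_eq_sum_mat]
    calc |∑ y' : ↥(bset D), mat G y'' y' * QB D (fun w => S x' w) y'|
        ≤ ∑ y' : ↥(bset D), |mat G y'' y' * QB D (fun w => S x' w) y'| := Finset.abs_sum_le_sum_abs _ _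
      _ ≤ ∑ y' : ↥(bset D), C₁ * ((geom D).len y'' ^ 4)⁻¹ * Real.exp (-(δ₁ / 2 * (geom D).dist y'' y')) *
            ((W D y')⁻¹ * (C * (geom D).len (blkOf D x') ^ n *
              Real.exp (-(δ₀ / 2 * (geom D).dist (blkOf D x') y')))) := Finset.sum_le_sum fun y' _ => by
          rw [abs_mul]
          exact mul_le_mul (hmat y'' y') (hv y') (abs_nonneg _) (mul_nonneg hn4 (Real.exp_nonneg _))
      _ = C₁ * ((geom D).len y'' ^ 4)⁻¹ * (C * (geom D).len (blkOf D x') ^ n) *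
            ∑ y' : ↥(bset D), Real.exp (-(δ₀ / 2 * (geom D).dist (blkOf D x') y')) * (W D y')⁻¹ *
              Real.exp (-(δ₁ / 2 * (geom D).dist y' y'')) := by
          rw [Finset.mul_sum]
          refine Finset.sum_congr rfl fun y' _ => ?_
          have hs : (geom D).dist y'' y' = (geom D).dist y' y'' := symmB D y'' y'
          rw [hs]
          ring
      _ ≤ C₁ * ((geom D).len y'' ^ 4)⁻¹ * (C * (geom D).len (blkOf D x') ^ n) *
            (((ℓ : ℝ) + 1) ^ (d + 1) * cK * (W D (blkOf D x'))⁻¹ *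
              Real.exp (-(4 * σ * (geom D).dist (blkOf D x') y''))) :=
          mul_le_mul_of_nonneg_left h2' (mul_nonneg hn4 hpn)
      _ = _ := by ring
  -- the column `u = Q′*(G(…))` on the fine lattice, decaying from `y(x′)` with the weight `(L^{j(z)})⁻⁴`
  obtain ⟨KR, hKR⟩ : ∃ KR : ℝ, KR = C₁ * C * ((ℓ : ℝ) + 1) ^ (d + 1) * cK * (geom D).len (blkOf D x') ^ n *
      (W D (blkOf D x'))⁻¹ := ⟨_, rfl⟩
  have hKR0 : 0 ≤ KR := by
    rw [hKR]
    exact mul_nonneg (mul_nonneg (by positivity) (pow_nonneg (hlen0 _) n)) (inv_nonneg.2 (W_pos D _).le)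
  have hu : ∀ z : ↥(boxDom (N0 ℓ Mh k P)), |QsB D (G (QB D fun w => S x' w)) z| ≤
      KR * (((geom D).len (blkOf D z) ^ 4)⁻¹ * Real.exp (-(4 * σ * (geom D).dist (blkOf D z) (blkOf D x')))) := by
    intro z
    have hs : (geom D).dist (blkOf D z) (blkOf D x') = (geom D).dist (blkOf D x') (blkOf D z) := symmB D _ _
    rw [QsB_apply, hKR, hs]
    have h := hGv (blkOf D z)
    calc |G (QB D fun w => S x' w) (blkOf D z)| ≤ _ := h
      _ = _ := by ring
  -- STEP L (Prop. 2.2 for `T`, the weight `(L^{j″})⁻⁴` moved to `y(x)` by (2.60), summed by (2.61), (2.54))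
  have hf4 : ∀ y y'' : (geom D).Site, ((geom D).len y'' ^ 4)⁻¹ ≤
      ((ℓ : ℝ) + 1) ^ 4 * Real.exp (2 * σ * (geom D).dist y y'') * ((geom D).len y ^ 4)⁻¹ :=
    fun y y'' => inv_pow_len_le hMh1 hP hRMone 4 (by positivity) (hthr 4 (2 * σ) (by omega) (by linarith)) y y''
  have hTu : |T (QsB D (G (QB D fun w => S x' w))) x| ≤
      KR * (C * ((ℓ : ℝ) + 1) ^ 4 * cK) * ((geom D).len (blkOf D x) ^ m * ((geom D).len (blkOf D x) ^ 4)⁻¹) *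
        Real.exp (-(2 * σ * (geom D).dist (blkOf D x) (blkOf D x'))) := by
    have h1 := abs_apply_le_of_levelBound (g := geom D) (blkOf D) hT
      (p := fun b => ((geom D).len b ^ 4)⁻¹ * Real.exp (-(4 * σ * (geom D).dist b (blkOf D x')))) hKR0
      (fun b => mul_nonneg (inv_nonneg.2 (pow_nonneg (hlen0 b) 4)) (Real.exp_nonneg _)) hu x
    have h2 := levelConv_le (g := geom D) htri hdnn (σ₁ := δ₀ / 2) (σ₂ := 4 * σ) (β := 2 * σ) (ρ := 2 * σ)
      (τ := 2 * σ) (A := ((ℓ : ℝ) + 1) ^ 4) (c := cK) (by positivity) (by linarith) (by linarith) (by positivity)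
      (f := fun b => ((geom D).len b ^ 4)⁻¹) (fun b => inv_nonneg.2 (pow_nonneg (hlen0 b) 4)) hf4
      (hrow (2 * σ) (by linarith)) (blkOf D x) (blkOf D x')
    refine h1.trans ?_
    have hq : 0 ≤ C * (geom D).len (blkOf D x) ^ m := mul_nonneg hC.le (pow_nonneg (hlen0 _) m)
    have hsum : ∑ b' : (geom D).Site, C * (geom D).len (blkOf D x) ^ m *
          Real.exp (-(δ₀ / 2 * (geom D).dist (blkOf D x) b')) *
          (((geom D).len b' ^ 4)⁻¹ * Real.exp (-(4 * σ * (geom D).dist b' (blkOf D x'))))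
        = C * (geom D).len (blkOf D x) ^ m * ∑ b' : (geom D).Site,
            Real.exp (-(δ₀ / 2 * (geom D).dist (blkOf D x) b')) * ((geom D).len b' ^ 4)⁻¹ *
              Real.exp (-(4 * σ * (geom D).dist b' (blkOf D x'))) := by
      rw [Finset.mul_sum]
      exact Finset.sum_congr rfl fun b' _ => by ring
    rw [hsum]
    calc KR * (C * (geom D).len (blkOf D x) ^ m * ∑ b' : (geom D).Site,
          Real.exp (-(δ₀ / 2 * (geom D).dist (blkOf D x) b')) * ((geom D).len b' ^ 4)⁻¹ *
            Real.exp (-(4 * σ * (geom D).dist b' (blkOf D x'))))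
        ≤ KR * (C * (geom D).len (blkOf D x) ^ m * (((ℓ : ℝ) + 1) ^ 4 * cK * ((geom D).len (blkOf D x) ^ 4)⁻¹ *
            Real.exp (-(2 * σ * (geom D).dist (blkOf D x) (blkOf D x'))))) :=
          mul_le_mul_of_nonneg_left (mul_le_mul_of_nonneg_left h2 hq) hKR0
      _ = _ := by ring
  -- the right prefactor `(L^{j(x′)})ⁿ` moved to `y(x)` by (2.60): `(L^{j′})ⁿ ≤ Lⁿe^{σd(y(x),y(x′))}(Lʲ)ⁿ ≤ L²e^{σd}(Lʲ)ⁿ`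
  have hpn : (geom D).len (blkOf D x') ^ n ≤
      ((ℓ : ℝ) + 1) ^ 2 * Real.exp (σ * (geom D).dist (blkOf D x) (blkOf D x')) * (geom D).len (blkOf D x) ^ n := by
    have h := pow_len_le hMh1 hP hRMone n hσ0.le (hthr n σ (by omega) le_rfl) (blkOf D x) (blkOf D x')
    refine h.trans (mul_le_mul_of_nonneg_right (mul_le_mul_of_nonneg_right (pow_le_pow_right₀ hL1 hn)
      (Real.exp_nonneg _)) (pow_nonneg (hlen0 _) n))
  -- assembly
  have hlx : (geom D).len (blkOf D x) = ((ℓ : ℝ) + 1) ^ D.lev x.1 := len_blkOf D x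
  have hWx' : 0 < W D (blkOf D x') := W_pos D _
  have hlenx : 0 < (geom D).len (blkOf D x) := len_pos D _
  have hE : Real.exp (-(2 * σ * (geom D).dist (blkOf D x) (blkOf D x'))) *
      Real.exp (σ * (geom D).dist (blkOf D x) (blkOf D x')) =
      Real.exp (-(σ * (geom D).dist (blkOf D x) (blkOf D x'))) := by
    rw [← Real.exp_add]; congr 1; ring
  refine hTu.trans ?_
  rw [hKR, ← hlx]
  -- everything but `len(y(x′))ⁿ` and the final exponential is a nonnegative scalar
  have hrest : 0 ≤ C₁ * C * ((ℓ : ℝ) + 1) ^ (d + 1) * cK * (W D (blkOf D x'))⁻¹ * (C * ((ℓ : ℝ) + 1) ^ 4 * cK) *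
      ((geom D).len (blkOf D x) ^ m * ((geom D).len (blkOf D x) ^ 4)⁻¹) *
      Real.exp (-(2 * σ * (geom D).dist (blkOf D x) (blkOf D x'))) := by
    have h1 : 0 ≤ C₁ * C * ((ℓ : ℝ) + 1) ^ (d + 1) * cK := by positivity
    have h2 : 0 ≤ C₁ * C * ((ℓ : ℝ) + 1) ^ (d + 1) * cK * (W D (blkOf D x'))⁻¹ := mul_nonneg h1 (inv_nonneg.2 hWx'.le)
    have h3 : 0 ≤ C₁ * C * ((ℓ : ℝ) + 1) ^ (d + 1) * cK * (W D (blkOf D x'))⁻¹ * (C * ((ℓ : ℝ) + 1) ^ 4 * cK) :=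
      mul_nonneg h2 (by positivity)
    exact mul_nonneg (mul_nonneg h3 (mul_nonneg (pow_nonneg hlenx.le m) (inv_nonneg.2 (pow_nonneg hlenx.le 4))))
      (Real.exp_nonneg _)
  calc C₁ * C * ((ℓ : ℝ) + 1) ^ (d + 1) * cK * (geom D).len (blkOf D x') ^ n * (W D (blkOf D x'))⁻¹ *
        (C * ((ℓ : ℝ) + 1) ^ 4 * cK) * ((geom D).len (blkOf D x) ^ m * ((geom D).len (blkOf D x) ^ 4)⁻¹) *
        Real.exp (-(2 * σ * (geom D).dist (blkOf D x) (blkOf D x')))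
      = C₁ * C * ((ℓ : ℝ) + 1) ^ (d + 1) * cK * (W D (blkOf D x'))⁻¹ * (C * ((ℓ : ℝ) + 1) ^ 4 * cK) *
        ((geom D).len (blkOf D x) ^ m * ((geom D).len (blkOf D x) ^ 4)⁻¹) *
        Real.exp (-(2 * σ * (geom D).dist (blkOf D x) (blkOf D x'))) * (geom D).len (blkOf D x') ^ n := by ring
    _ ≤ C₁ * C * ((ℓ : ℝ) + 1) ^ (d + 1) * cK * (W D (blkOf D x'))⁻¹ * (C * ((ℓ : ℝ) + 1) ^ 4 * cK) *
        ((geom D).len (blkOf D x) ^ m * ((geom D).len (blkOf D x) ^ 4)⁻¹) *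
        Real.exp (-(2 * σ * (geom D).dist (blkOf D x) (blkOf D x'))) *
        (((ℓ : ℝ) + 1) ^ 2 * Real.exp (σ * (geom D).dist (blkOf D x) (blkOf D x')) * (geom D).len (blkOf D x) ^ n) :=
        mul_le_mul_of_nonneg_left hpn hrest
    _ = B * ((geom D).len (blkOf D x) ^ m * (geom D).len (blkOf D x) ^ n * ((geom D).len (blkOf D x) ^ 4)⁻¹) *
        (W D (blkOf D x'))⁻¹ * Real.exp (-(σ * (geom D).dist (blkOf D x) (blkOf D x'))) := by
        rw [hB, ← hE]; ring
    _ ≤ (B + 1) * ((geom D).len (blkOf D x) ^ m * (geom D).len (blkOf D x) ^ n * ((geom D).len (blkOf D x) ^ 4)⁻¹) *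
        (W D (blkOf D x'))⁻¹ * Real.exp (-(σ * (geom D).dist (blkOf D x) (blkOf D x'))) := by
        have h0 : 0 ≤ ((geom D).len (blkOf D x) ^ m * (geom D).len (blkOf D x) ^ n *
            ((geom D).len (blkOf D x) ^ 4)⁻¹) * (W D (blkOf D x'))⁻¹ *
            Real.exp (-(σ * (geom D).dist (blkOf D x) (blkOf D x'))) :=
          mul_nonneg (mul_nonneg (mul_nonneg (mul_nonneg (pow_nonneg hlenx.le m) (pow_nonneg hlenx.le n))
            (inv_nonneg.2 (pow_nonneg hlenx.le 4))) (inv_nonneg.2 hWx'.le)) (Real.exp_nonneg _)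
        have : B * (((geom D).len (blkOf D x) ^ m * (geom D).len (blkOf D x) ^ n *
            ((geom D).len (blkOf D x) ^ 4)⁻¹) * (W D (blkOf D x'))⁻¹ *
            Real.exp (-(σ * (geom D).dist (blkOf D x) (blkOf D x')))) ≤ (B + 1) * _ :=
          mul_le_mul_of_nonneg_right (by linarith) h0
        simpa only [mul_assoc] using this

end Kernel

/-! ## §4  (3.49) at U = 1 on the `k`-level box family: all four entries with the genuine level prefactors -/

section Main

/-- **(3.49) AT U = 1 ON THE `k`-LEVEL NEUMANN-BOX FAMILY — ALL FOUR ENTRIES, GENUINE LEVEL PREFACTORS, THE INVERSE ENTERING BY ITS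
(2.87)-BOUND**: for every `C₁, δ₁ > 0` there are `ρ, B, M₀ > 0`, `N₀ ≥ 1` (functions of `d, ℓ`, the weight windows, `C₁, δ₁`) such that
for every number of levels `k`, every `M_h ≥ 3` with `L·M_h ≥ M₀`, every `R ≥ 2L` with `R·L·M_h ≥ N₀ + 1`, every box `P`, every nested
family `D` of block-union domains with (2.1)–(2.2), every weight sequence in the windows with `a_{i+1} = aNext ℓ a_i c_i`, EVERY operator
`G` on `𝔅` with `|G(y, y′)| ≦ C₁(Lʲ)⁻⁴(L^{j′})^{−(d+1)}e^{−½δ₁d(y,y′)}` (the printed bound (2.87) of [B6] Prop. 2.3 for `(Q′G′²Q′*)⁻¹`, in the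
(2.69) convention `G(y, y′) = mat G y y′ / W(y′)`), and all fine points `x, x′` of the box (blocks `y(x), y(x′)`, levels `j = D.lev x`,
`j′ = D.lev x′`, so `W(y(x′)) = (L^{j′})^{d+1}`) and axes `μ, ν`, for `P = G′Q′*GQ′G′` (`pProjML`), `D_μ = dMat μ`, `D*_ν = (dMat ν)ᵀ`:
`|P(x,x′)| ≦ B·(L^{j′})^{−(d+1)}·e^{−ρd(y(x),y(x′))}`, `|(D_μP)(x,x′)| ≦ B(Lʲ)⁻¹(L^{j′})^{−(d+1)}e^{−ρd}`, `|(PD*_ν)(x,x′)| ≦ B(Lʲ)⁻¹(L^{j′})^{−(d+1)}e^{−ρd}`,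
`|(D_μPD*_ν)(x,x′)| ≦ B(Lʲ)⁻²(L^{j′})^{−(d+1)}e^{−ρd}` — matrix entries `T(x,x′) = (Tδ_{x′})(x)` of the genuine finite operators (at η = 1
the entry IS the kernel of the pairing of p. 391; print's `(L^{j′}η)^{−d}` in its `d` dimensions = `(L^{j′})^{−(d+1)}` here).  Mechanism
(p. 399 «using again Lemma 2.1», [4] ↦ [B6] §2 at U = 1): §3 for the four words, the right row being `row_{x′}G′` (entries 1–2) or
`row_{x′}(D_νG′)` (entries 3–4) by THE SYMMETRY `G′ᵀ = G′` (§1), with [B6] Prop. 2.2 entries 1/2 for the genuine `G′`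
(`prop22_entries1236_multiLevelBox`, p21). [cite: Balaban1985BackgroundPropagators, (3.49) p.399, (3.25) p.394, p.391; Balaban1984PropagatorsII, Prop. 2.2 (2.67) p.234, Prop. 2.3 (2.87) p.238, Lemma 2.1 (2.60)–(2.61) p.234, (2.52)–(2.55) p.232, (2.13)–(2.14) p.225] -/
theorem ineq349_multiLevelBox_of_inverse (d ℓ : ℕ) (hℓ : 1 ≤ ℓ) (aminus aplus a2minus a2plus : ℝ) (ha : 0 < aminus)
    (ha2 : 0 < a2minus) {C₁ δ₁ : ℝ} (hC₁ : 0 < C₁) (hδ₁ : 0 < δ₁) :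
    ∃ ρ B M₀ : ℝ, ∃ N₀ : ℕ, 0 < ρ ∧ 0 < B ∧ 0 < M₀ ∧ 0 < N₀ ∧
      ∀ (k Mh R : ℕ), 3 ≤ Mh → M₀ ≤ ((ℓ : ℝ) + 1) * Mh → 2 * (ℓ + 1) ≤ R → N₀ + 1 ≤ R * ((ℓ + 1) * Mh) →
      ∀ (P : Fin (d + 1) → ℕ) (_hP : ∀ μ, 1 ≤ P μ) (D : Domains d ℓ Mh k P R) (a c : ℕ → ℝ),
        (∀ i, aminus ≤ a i ∧ a i ≤ aplus) → (∀ i, a2minus ≤ c i ∧ c i ≤ a2plus) →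
        (∀ i, a (i + 1) = aNext ℓ (a i) (c i)) →
        ∀ G : Module.End ℝ (↥(bset D) → ℝ),
          (∀ y y' : ↥(bset D), |mat G y y' / W D y'| ≤
            C₁ * (geom D).len y ^ (-(4 : ℝ)) * (geom D).len y' ^ (-((d + 1 : ℕ) : ℝ)) *
              Real.exp (-(δ₁ / 2 * (geom D).dist y y'))) →
          ∀ (x x' : ↥(boxDom (N0 ℓ Mh k P))),
            |pProjML D a G (Pi.single x' 1) x| ≤
              B * (W D (blkOf D x'))⁻¹ * Real.exp (-(ρ * (geom D).dist (blkOf D x) (blkOf D x'))) ∧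
            (∀ μ : Fin (d + 1), |(dMat (N0 ℓ Mh k P) μ *ᵥ pProjML D a G (Pi.single x' 1)) x| ≤
              B * (((ℓ : ℝ) + 1) ^ D.lev x.1)⁻¹ * (W D (blkOf D x'))⁻¹ *
                Real.exp (-(ρ * (geom D).dist (blkOf D x) (blkOf D x')))) ∧
            (∀ ν : Fin (d + 1), |pProjML D a G ((dMat (N0 ℓ Mh k P) ν)ᵀ *ᵥ Pi.single x' 1) x| ≤
              B * (((ℓ : ℝ) + 1) ^ D.lev x.1)⁻¹ * (W D (blkOf D x'))⁻¹ *
                Real.exp (-(ρ * (geom D).dist (blkOf D x) (blkOf D x')))) ∧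
            (∀ μ ν : Fin (d + 1),
              |(dMat (N0 ℓ Mh k P) μ *ᵥ pProjML D a G ((dMat (N0 ℓ Mh k P) ν)ᵀ *ᵥ Pi.single x' 1)) x| ≤
              B * ((((ℓ : ℝ) + 1) ^ D.lev x.1) ^ 2)⁻¹ * (W D (blkOf D x'))⁻¹ *
                Real.exp (-(ρ * (geom D).dist (blkOf D x) (blkOf D x')))) := by
  obtain ⟨δ₀, C, ρ, B, M₀, N₀, -, -, hρ, hB, hM₀, hN₀, h⟩ :=
    pKernel_decay_of_inverse d ℓ hℓ aminus aplus a2minus a2plus ha ha2 hC₁ hδ₁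
  refine ⟨ρ, B, M₀, N₀, hρ, hB, hM₀, hN₀, ?_⟩
  intro k Mh R hMh hM hR hRM P hP D a c haw hcw hac G hG x x'
  obtain ⟨hTG, hTD, hkey⟩ := h k Mh R hMh hM hR hRM P hP D a c haw hcw hac
  have key := hkey G hG
  have hL0 : (0 : ℝ) < (ℓ : ℝ) + 1 := by positivity
  set lam : ℝ := ((ℓ : ℝ) + 1) ^ D.lev x.1 with hlam
  have hlam0 : 0 < lam := pow_pos hL0 _
  have hW0 : 0 ≤ (W D (blkOf D x'))⁻¹ := inv_nonneg.2 (W_pos D _).le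
  have hE : 0 ≤ Real.exp (-(ρ * (geom D).dist (blkOf D x) (blkOf D x'))) := Real.exp_nonneg _
  -- the composite `∂_μ·G′` as an endomorphism and its action
  have hDe : ∀ (μ : Fin (d + 1)) (u : ↥(boxDom (N0 ℓ Mh k P)) → ℝ),
      (Matrix.toLin' (dMat (N0 ℓ Mh k P) μ * gml (N0 ℓ Mh k P) ℓ k D.lev a)) u =
        dMat (N0 ℓ Mh k P) μ *ᵥ (gml (N0 ℓ Mh k P) ℓ k D.lev a *ᵥ u) := fun μ u => by
    rw [Matrix.toLin'_apply, Matrix.mulVec_mulVec]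
  refine ⟨?_, fun μ => ?_, fun ν => ?_, fun μ ν => ?_⟩
  · -- entry 1: `T = G′` (m = 2), row `G′` (n = 2): prefactor `λ²λ²λ⁻⁴ = 1`
    have h := key (Matrix.toLin' (gml (N0 ℓ Mh k P) ℓ k D.lev a)) (gml (N0 ℓ Mh k P) ℓ k D.lev a) 2 2 le_rfl le_rfl
      hTG hTG x x'
    rw [Matrix.toLin'_apply] at h
    rw [pProjML_single]
    refine h.trans (le_of_eq ?_)
    rw [← hlam]
    field_simp
  · -- entry 2: `T = ∂_μG′` (m = 1), row `G′` (n = 2): prefactor `λλ²λ⁻⁴ = λ⁻¹`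
    have h := key (Matrix.toLin' (dMat (N0 ℓ Mh k P) μ * gml (N0 ℓ Mh k P) ℓ k D.lev a))
      (gml (N0 ℓ Mh k P) ℓ k D.lev a) 1 2 (by norm_num) le_rfl (hTD μ) hTG x x'
    rw [hDe] at h
    rw [pProjML_single]
    refine h.trans (le_of_eq ?_)
    rw [← hlam]
    field_simp
  · -- entry 3: `T = G′` (m = 2), row `∂_νG′` (n = 1): prefactor `λ²λλ⁻⁴ = λ⁻¹`
    have h := key (Matrix.toLin' (gml (N0 ℓ Mh k P) ℓ k D.lev a))
      (dMat (N0 ℓ Mh k P) ν * gml (N0 ℓ Mh k P) ℓ k D.lev a) 2 1 le_rfl (by norm_num) hTG (hTD ν) x x'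
    rw [Matrix.toLin'_apply] at h
    rw [pProjML_dMat_transpose_single]
    refine h.trans (le_of_eq ?_)
    rw [← hlam]
    field_simp
  · -- entry 4: `T = ∂_μG′` (m = 1), row `∂_νG′` (n = 1): prefactor `λλλ⁻⁴ = λ⁻²`
    have h := key (Matrix.toLin' (dMat (N0 ℓ Mh k P) μ * gml (N0 ℓ Mh k P) ℓ k D.lev a))
      (dMat (N0 ℓ Mh k P) ν * gml (N0 ℓ Mh k P) ℓ k D.lev a) 1 1 (by norm_num) (by norm_num) (hTD μ) (hTD ν) x x'
    rw [hDe] at h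
    rw [pProjML_dMat_transpose_single]
    refine h.trans (le_of_eq ?_)
    rw [← hlam]
    field_simp

/-- **the same four bounds for the off-identity part of `R` ((3.25)), `R − 1 = −P`** — the form in which (3.49) is consumed for
«the operator R, or DRD\*» (p. 399, l. 5). [cite: Balaban1985BackgroundPropagators, (3.49) p.399, (3.25) p.394] -/
theorem ineq349_multiLevelBox_R_of_inverse (d ℓ : ℕ) (hℓ : 1 ≤ ℓ) (aminus aplus a2minus a2plus : ℝ) (ha : 0 < aminus)
    (ha2 : 0 < a2minus) {C₁ δ₁ : ℝ} (hC₁ : 0 < C₁) (hδ₁ : 0 < δ₁) :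
    ∃ ρ B M₀ : ℝ, ∃ N₀ : ℕ, 0 < ρ ∧ 0 < B ∧ 0 < M₀ ∧ 0 < N₀ ∧
      ∀ (k Mh R : ℕ), 3 ≤ Mh → M₀ ≤ ((ℓ : ℝ) + 1) * Mh → 2 * (ℓ + 1) ≤ R → N₀ + 1 ≤ R * ((ℓ + 1) * Mh) →
      ∀ (P : Fin (d + 1) → ℕ) (_hP : ∀ μ, 1 ≤ P μ) (D : Domains d ℓ Mh k P R) (a c : ℕ → ℝ),
        (∀ i, aminus ≤ a i ∧ a i ≤ aplus) → (∀ i, a2minus ≤ c i ∧ c i ≤ a2plus) →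
        (∀ i, a (i + 1) = aNext ℓ (a i) (c i)) →
        ∀ G : Module.End ℝ (↥(bset D) → ℝ),
          (∀ y y' : ↥(bset D), |mat G y y' / W D y'| ≤
            C₁ * (geom D).len y ^ (-(4 : ℝ)) * (geom D).len y' ^ (-((d + 1 : ℕ) : ℝ)) *
              Real.exp (-(δ₁ / 2 * (geom D).dist y y'))) →
          ∀ (x x' : ↥(boxDom (N0 ℓ Mh k P))),
            |(rProjML D a G - 1) (Pi.single x' 1) x| ≤
              B * (W D (blkOf D x'))⁻¹ * Real.exp (-(ρ * (geom D).dist (blkOf D x) (blkOf D x'))) ∧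
            (∀ μ : Fin (d + 1), |(dMat (N0 ℓ Mh k P) μ *ᵥ (rProjML D a G - 1) (Pi.single x' 1)) x| ≤
              B * (((ℓ : ℝ) + 1) ^ D.lev x.1)⁻¹ * (W D (blkOf D x'))⁻¹ *
                Real.exp (-(ρ * (geom D).dist (blkOf D x) (blkOf D x')))) ∧
            (∀ ν : Fin (d + 1), |(rProjML D a G - 1) ((dMat (N0 ℓ Mh k P) ν)ᵀ *ᵥ Pi.single x' 1) x| ≤
              B * (((ℓ : ℝ) + 1) ^ D.lev x.1)⁻¹ * (W D (blkOf D x'))⁻¹ *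
                Real.exp (-(ρ * (geom D).dist (blkOf D x) (blkOf D x')))) ∧
            (∀ μ ν : Fin (d + 1),
              |(dMat (N0 ℓ Mh k P) μ *ᵥ (rProjML D a G - 1) ((dMat (N0 ℓ Mh k P) ν)ᵀ *ᵥ Pi.single x' 1)) x| ≤
              B * ((((ℓ : ℝ) + 1) ^ D.lev x.1) ^ 2)⁻¹ * (W D (blkOf D x'))⁻¹ *
                Real.exp (-(ρ * (geom D).dist (blkOf D x) (blkOf D x')))) := by
  obtain ⟨ρ, B, M₀, N₀, hρ, hB, hM₀, hN₀, h⟩ :=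
    ineq349_multiLevelBox_of_inverse d ℓ hℓ aminus aplus a2minus a2plus ha ha2 hC₁ hδ₁
  refine ⟨ρ, B, M₀, N₀, hρ, hB, hM₀, hN₀, ?_⟩
  intro k Mh R hMh hM hR hRM P hP D a c haw hcw hac G hG x x'
  obtain ⟨h1, h2, h3, h4⟩ := h k Mh R hMh hM hR hRM P hP D a c haw hcw hac G hG x x'
  have hsub : rProjML D a G - 1 = -pProjML D a G := by
    rw [rProjML_eq_one_sub_pProjML]; abel
  simp only [hsub, LinearMap.neg_apply, Pi.neg_apply, abs_neg, Matrix.mulVec_neg]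
  exact ⟨h1, h2, h3, h4⟩

end Main

end

end Literature.MathematicalPhysics.QuantumFieldTheory.Balaban1983to89.B9Ineq349MultiLevelBoxL0
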